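import Summits.Ventures.PercRepro.SevenThreeWorld
import Summits.Ventures.PercRepro.SevenThreeDstar
import Summits.Ventures.PercRepro.SevenThreeStarTransfer

/-!
# PercRepro — the `(7,3)` cell: the star fibre of a series class (p3, gen 16)

In a reduced world of rank `7` (`SevenThreeWorld.lean`) fix a series class `N` of `E = T ∪ W` meeting `W`, with
`t_P = |N ∩ T|`, `c_P = |N ∩ W|`, `ℓ₀ = |L₀|`. The witnesses of nullity two whose removed set `Z = W ∖ X` has
`Z ∖ L₀ ⊆ N` form the STAR FIBRE of `N`: `Z = Z_P ∪ Z_ℓ` with `∅ ≠ Z_P ⊆ N ∩ W` and `Z_ℓ ⊆ L₀`. Every such witness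
has cyclic part `K_N = E ∖ (N ∪ L₀)` and `t_P + (c_P − z_P) + (ℓ₀ − z_ℓ)` coloops, so its denominator is the star
table's `DstarN` (`D_eq_DstarN`) and its bracket is `bracketN t_P c_P ℓ₀ cs z_P z_ℓ / Ls` (`bracket_eq_bracketN`,
given the table's exact divisions `divOK`). Summing over the fibre by `(z_P, z_ℓ)` gives
`Σ_{fibre} bracket = deltaStarN t_P c_P ℓ₀ cs / Ls` (`star_fibre_sum`) — `Δ_P` of mine-2's §27.1 in the kernel
(`P3-C025-seven-three-plan.md` §9 (R3)(b)).
-/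

namespace PercRepro

namespace SevenThree

open Finset ThmH SixThree

variable {α : Type*} [DecidableEq α] {M : Matroid α} [M.Finite]

/-- A series class of the world avoids the coloops. -/
theorem disjoint_serClass_coloops {T W N : Finset α} (hN : N ∈ serClasses M (T ∪ W)) :
    Disjoint N (coloopsOf M (T ∪ W)) := by
  obtain ⟨e, -, rfl⟩ := mem_serClasses.1 hN
  exact (disjoint_cyclicPart_coloopsOf (T ∪ W)).mono_left (serClass_subset _ e)

/-- A series class of the world lies in the world. -/
theorem serClass_subset_world {T W N : Finset α} (hN : N ∈ serClasses M (T ∪ W)) : N ⊆ T ∪ W := by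
  obtain ⟨e, -, rfl⟩ := mem_serClasses.1 hN
  exact (serClass_subset _ e).trans (cyclicPart_subset M _)

/-- `|N| = |N ∩ T| + |N ∩ W|`. -/
theorem card_serClass_split {T W N : Finset α} (h : ReducedWorld M T W) (hN : N ∈ serClasses M (T ∪ W)) :
    N.card = (N ∩ T).card + (N ∩ W).card := by
  have hsub := serClass_subset_world hN
  rw [← Finset.card_union_of_disjoint (h.disj.mono (Finset.inter_subset_right) (Finset.inter_subset_right))]
  congr 1
  ext e
  simp only [Finset.mem_union, Finset.mem_inter]
  constructor
  · intro he
    rcases Finset.mem_union.1 (hsub he) with hh | hh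
    · exact Or.inl ⟨he, hh⟩
    · exact Or.inr ⟨he, hh⟩
  · rintro (⟨he, -⟩ | ⟨he, -⟩) <;> exact he

/-- **The flat condition on a star**: `|N ∩ W| + |L₀| ≤ 4` for a series class `N` meeting `W` — otherwise the rank of
`E ∖ ((N ∩ W) ∪ L₀)` would be `3` while it contains `T` and a point of `W` outside `cl(T)`. -/
theorem card_inter_add_card_coloops_le {T W N : Finset α} (h : ReducedWorld M T W) (hr : M.eRank = 7)
    (hN : N ∈ serClasses M (T ∪ W)) (hNW : (N ∩ W).Nonempty) :
    (N ∩ W).card + (coloopsOf M (T ∪ W)).card ≤ 4 := by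
  set L := coloopsOf M (T ∪ W) with hL
  have hLW : L ⊆ W := coloopsOf_world_subset h hr
  have hdisj : Disjoint (N ∩ W) L := (disjoint_serClass_coloops hN).mono_left Finset.inter_subset_left
  set Z := (N ∩ W) ∪ L with hZ
  have hZW : Z ⊆ W := Finset.union_subset Finset.inter_subset_right hLW
  have hZE : Z ⊆ T ∪ W := hZW.trans Finset.subset_union_right
  have hZL : Z \ L = N ∩ W := by
    rw [hZ, Finset.union_sdiff_right, Finset.sdiff_eq_self_of_disjoint hdisj]
  have hd1 : drk M (T ∪ W) Z = 1 := by
    apply (drk_eq_one_iff_subset_serClass h hZE).2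
    rw [hZL]
    exact ⟨hNW, N, hN, Finset.inter_subset_left⟩
  have h1 := nrk_sdiff_add_card_eq (M := M) (T ∪ W) Z
  rw [nrk_world h hr, hd1] at h1
  have hcard : Z.card = (N ∩ W).card + L.card := Finset.card_union_of_disjoint hdisj
  -- `E ∖ Z ⊇ T`, and a point of `W ∖ Z` together with `T` has rank `4`
  by_contra hcon
  have hZ5 : 5 ≤ Z.card := by omega
  have hWZ : (W \ Z).Nonempty := by
    apply Finset.card_pos.1
    rw [Finset.card_sdiff_of_subset hZW, h.W_card]
    have := Finset.card_le_card hZW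
    rw [h.W_card] at this
    by_contra hh
    have hZ7 : Z.card = 7 := by omega
    -- then `E ∖ Z ⊇ T` has rank `≥ 3` but `nrk (E ∖ Z) + 7 = 8`
    have hT : T ⊆ (T ∪ W) \ Z := by
      intro t ht
      rw [Finset.mem_sdiff]
      exact ⟨Finset.mem_union_left W ht, fun hz => Finset.disjoint_left.1 h.disj ht (hZW hz)⟩
    have h2 : nrk M T ≤ nrk M ((T ∪ W) \ Z) := nrk_mono hT
    have h3 : nrk M T = 3 := nrk_eq_of_eRk h.T_rank
    omega
  obtain ⟨w, hw⟩ := hWZ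
  rw [Finset.mem_sdiff] at hw
  have hins : insert w T ⊆ (T ∪ W) \ Z := by
    intro e he
    rw [Finset.mem_insert] at he
    rw [Finset.mem_sdiff]
    rcases he with rfl | he
    · exact ⟨Finset.mem_union_right T hw.1, hw.2⟩
    · exact ⟨Finset.mem_union_left W he, fun hz => Finset.disjoint_left.1 h.disj he (hZW hz)⟩
  have h4 : nrk M (insert w T) ≤ nrk M ((T ∪ W) \ Z) := nrk_mono hins
  rw [nrk_insert_T h hw.1] at h4
  omega

/-- The data of a star witness: for `Z ⊆ (N ∩ W) ∪ L₀` meeting `N`, `X = W ∖ Z` gives a witness `T ∪ X` of nullity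
two with `|T ∪ X| + |Z| = 10`, coloops `(N ∪ L₀) ∖ Z` and cyclic part `E ∖ (N ∪ L₀)`. -/
theorem star_witness_data {T W N Z : Finset α} (h : ReducedWorld M T W) (hr : M.eRank = 7)
    (hN : N ∈ serClasses M (T ∪ W)) (hZ : Z ⊆ (N ∩ W) ∪ coloopsOf M (T ∪ W)) (hZN : (Z ∩ N).Nonempty) :
    Z ⊆ W ∧ nrk M (T ∪ (W \ Z)) + 2 = (T ∪ (W \ Z)).card ∧ (T ∪ (W \ Z)).card + Z.card = 10 ∧
      coloopsOf M (T ∪ (W \ Z)) = (N ∪ coloopsOf M (T ∪ W)) \ Z ∧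
      cyclicPart M (T ∪ (W \ Z)) = (T ∪ W) \ (N ∪ coloopsOf M (T ∪ W)) := by
  set L := coloopsOf M (T ∪ W) with hL
  have hLW : L ⊆ W := coloopsOf_world_subset h hr
  have hZW : Z ⊆ W := hZ.trans (Finset.union_subset Finset.inter_subset_right hLW)
  have hZE : Z ⊆ T ∪ W := hZW.trans Finset.subset_union_right
  have hdisjNL : Disjoint N L := disjoint_serClass_coloops hN
  have hZL : Z \ L = Z ∩ N := by
    ext e
    simp only [Finset.mem_sdiff, Finset.mem_inter]
    constructor
    · rintro ⟨he, heL⟩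
      refine ⟨he, ?_⟩
      rcases Finset.mem_union.1 (hZ he) with hh | hh
      · exact (Finset.mem_inter.1 hh).1
      · exact absurd hh heL
    · rintro ⟨he, heN⟩
      exact ⟨he, fun heL => Finset.disjoint_left.1 hdisjNL heN heL⟩
  have hZLN : Z \ L ⊆ N := by rw [hZL]; exact Finset.inter_subset_right
  have hne : (Z \ L).Nonempty := by rw [hZL]; exact hZN
  have hsd : (T ∪ W) \ Z = T ∪ (W \ Z) := by
    have := world_sdiff_eq h (X := W \ Z) Finset.sdiff_subset
    rw [Finset.sdiff_sdiff_eq_self hZW] at this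
    exact this
  have hd1 : drk M (T ∪ W) Z = 1 := (drk_eq_one_iff_subset_serClass h hZE).2 ⟨hne, N, hN, hZLN⟩
  refine ⟨hZW, ?_, ?_, ?_, ?_⟩
  · have h1 := nrk_witness_add_three h hr (X := W \ Z) Finset.sdiff_subset
    rw [Finset.sdiff_sdiff_eq_self hZW, hd1] at h1
    omega
  · rw [Finset.card_union_of_disjoint (h.disj.mono_right Finset.sdiff_subset), Finset.card_sdiff_of_subset hZW,
      h.T_card, h.W_card]
    have := Finset.card_le_card hZW
    rw [h.W_card] at this
    omega
  · rw [← hsd]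
    exact coloopsOf_of_drk_one h hr hZE hN hZLN hne
  · rw [← hsd]
    unfold cyclicPart
    rw [coloopsOf_of_drk_one h hr hZE hN hZLN hne]
    ext e
    simp only [Finset.mem_sdiff, Finset.mem_union, not_and, not_not]
    constructor
    · rintro ⟨⟨he, heZ⟩, hh⟩
      exact ⟨he, fun hNL => heZ (hh hNL)⟩
    · rintro ⟨he, hh⟩
      refine ⟨⟨he, fun heZ => hh ?_⟩, fun hNL => absurd hNL hh⟩
      rcases Finset.mem_union.1 (hZ heZ) with h1 | h1
      · exact Or.inl (Finset.mem_inter.1 h1).1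
      · exact Or.inr h1

/-- **The bracket of a star witness is the table's `bracketN / Ls`**: for `Z ⊆ (N ∩ W) ∪ L₀` meeting `N`, with a class
list `L` of `K_N = E ∖ (N ∪ L₀)` and the exact divisions of the datum,
`Ls · bracket T (W ∖ Z) = bracketN t_P c_P ℓ₀ cs |Z ∩ N| |Z ∩ L₀|`. -/
theorem bracket_eq_bracketN {T W N Z : Finset α} (h : ReducedWorld M T W) (hr : M.eRank = 7)
    (hN : N ∈ serClasses M (T ∪ W)) (hZ : Z ⊆ (N ∩ W) ∪ coloopsOf M (T ∪ W)) (hZN : (Z ∩ N).Nonempty)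
    {L : List (Finset α)} (hL : IsClassList M ((T ∪ W) \ (N ∪ coloopsOf M (T ∪ W))) L)
    (hdiv : StarTable.divOK (N ∩ T).card (N ∩ W).card (coloopsOf M (T ∪ W)).card (L.map Finset.card) = true) :
    (StarTable.Ls : ℚ) * bracket M T (W \ Z) =
      ((StarTable.bracketN (N ∩ T).card (N ∩ W).card (coloopsOf M (T ∪ W)).card (L.map Finset.card)
        (Z ∩ N).card (Z ∩ coloopsOf M (T ∪ W)).card : ℤ) : ℚ) := by
  classical
  obtain ⟨hZW, hnul, hcard10, hcol, hcyc⟩ := star_witness_data h hr hN hZ hZN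
  have hdisjNL : Disjoint N (coloopsOf M (T ∪ W)) := disjoint_serClass_coloops hN
  -- the sizes
  have hZsplit : Z.card = (Z ∩ N).card + (Z ∩ (coloopsOf M (T ∪ W))).card := by
    rw [← Finset.card_union_of_disjoint (hdisjNL.mono Finset.inter_subset_right Finset.inter_subset_right)]
    congr 1
    ext e
    simp only [Finset.mem_union, Finset.mem_inter]
    constructor
    · intro he
      rcases Finset.mem_union.1 (hZ he) with hh | hh
      · exact Or.inl ⟨he, (Finset.mem_inter.1 hh).1⟩
      · exact Or.inr ⟨he, hh⟩
    · rintro (⟨he, -⟩ | ⟨he, -⟩) <;> exact he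
  have hzP : (Z ∩ N).card ≤ (N ∩ W).card :=
    Finset.card_le_card (fun e he => Finset.mem_inter.2 ⟨(Finset.mem_inter.1 he).2, hZW (Finset.mem_inter.1 he).1⟩)
  have hzl : (Z ∩ (coloopsOf M (T ∪ W))).card ≤ (coloopsOf M (T ∪ W)).card := Finset.card_le_card Finset.inter_subset_right
  have hzP0 : (Z ∩ N).card ≠ 0 := (Finset.card_pos.2 hZN).ne'
  have hNW : (N ∩ W).Nonempty := hZN.mono
    (fun e he => Finset.mem_inter.2 ⟨(Finset.mem_inter.1 he).2, hZW (Finset.mem_inter.1 he).1⟩)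
  have hflat := card_inter_add_card_coloops_le h hr hN hNW
  have hNcard := card_serClass_split h hN
  have hlp : (coloopsOf M (T ∪ (W \ Z))).card =
      (N ∩ T).card + ((N ∩ W).card - (Z ∩ N).card) + ((coloopsOf M (T ∪ W)).card - (Z ∩ (coloopsOf M (T ∪ W))).card) := by
    rw [hcol, Finset.card_sdiff_of_subset (hZ.trans (Finset.union_subset_union Finset.inter_subset_left
      (Finset.Subset.refl _))), Finset.card_union_of_disjoint hdisjNL]
    omega
  have hS5 : 5 ≤ (T ∪ (W \ Z)).card := by omega
  have hx : (T ∪ (W \ Z)).card - 3 = 7 - ((Z ∩ N).card + (Z ∩ (coloopsOf M (T ∪ W))).card) := by omega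
  have hL' : IsClassList M (cyclicPart M (T ∪ (W \ Z))) L := by rw [hcyc]; exact hL
  have hD := D_eq_DstarN (Finset.union_subset h.T_sub (Finset.sdiff_subset.trans h.W_sub)) hnul hS5 hL'
  rw [hlp, hx] at hD
  -- the witness condition: `3 < ρ(S) < 7` with `ρ(S) = |S| − 2 = 8 − |Z|`
  have hrank : M.eRk ((T ∪ (W \ Z) : Finset α) : Set α) = (((T ∪ (W \ Z)).card - 2 : ℕ) : ℕ∞) := by
    rw [← coe_nrk]
    congr 1
    omega
  have hXcard : (W \ Z).card = 7 - Z.card := by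
    rw [Finset.card_sdiff_of_subset hZW, h.W_card]
  unfold bracket StarTable.bracketN
  rw [hXcard]
  by_cases h2 : (Z ∩ N).card + (Z ∩ (coloopsOf M (T ∪ W))).card < 2
  · -- `|Z| = 1`: not a witness, no generic term
    have hw : ¬ IsWitness M T (W \ Z) := by
      unfold IsWitness
      rw [hrank]
      rintro ⟨-, hlt⟩
      have : (T ∪ (W \ Z)).card - 2 < 7 := by exact_mod_cast hlt
      omega
    rw [if_neg hw, if_neg (by omega), if_pos h2]
    simp
  · have hw : IsWitness M T (W \ Z) := by
      unfold IsWitness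
      rw [hrank]
      constructor
      · exact_mod_cast (by omega : 3 < (T ∪ (W \ Z)).card - 2)
      · exact_mod_cast (by omega : (T ∪ (W \ Z)).card - 2 < 7)
    rw [if_pos hw, if_neg h2]
    obtain ⟨hpos, hdvd⟩ := divOK_spec hdiv hzP hzP0 hzl (by omega)
    push_cast
    rw [Int.cast_div hdvd (by exact_mod_cast hpos.ne'), phiTermN_cast, ← hD]
    have hD0 : D M (T ∪ (W \ Z)) ≠ 0 := by
      rw [hD]
      exact_mod_cast hpos.ne'
    have hZ' : 7 - Z.card = 7 - ((Z ∩ N).card + (Z ∩ (coloopsOf M (T ∪ W))).card) := by omega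
    rw [hZ']
    by_cases h3 : 7 - ((Z ∩ N).card + (Z ∩ (coloopsOf M (T ∪ W))).card) ≤ 3
    · rw [if_pos h3, if_pos h3]
      have hc : ((Nat.choose (7 - ((Z ∩ N).card + (Z ∩ (coloopsOf M (T ∪ W))).card) + 3) 3 : ℕ) : ℚ) ≠ 0 := by
        have := Nat.choose_pos (show 3 ≤ 7 - ((Z ∩ N).card + (Z ∩ (coloopsOf M (T ∪ W))).card) + 3 by omega)
        exact_mod_cast this.ne'
      field_simp
    · rw [if_neg h3, if_neg h3]
      field_simp
      ring


open scoped Classical in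
/-- **THE STAR FIBRE SUM**: for a series class `N` of the world, a class list `L` of `K_N = E ∖ (N ∪ L₀)` and the exact
divisions of its datum, the brackets of the witnesses with `(W ∖ X) ∖ L₀` a nonempty subset of `N` sum to
`deltaStarN t_P c_P ℓ₀ cs / Ls` — `Δ_P` of §27.1. -/
theorem star_fibre_sum {T W N : Finset α} (h : ReducedWorld M T W) (hr : M.eRank = 7)
    (hN : N ∈ serClasses M (T ∪ W)) {L : List (Finset α)}
    (hL : IsClassList M ((T ∪ W) \ (N ∪ coloopsOf M (T ∪ W))) L)
    (hdiv : StarTable.divOK (N ∩ T).card (N ∩ W).card (coloopsOf M (T ∪ W)).card (L.map Finset.card) = true) :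
    ∑ X ∈ W.powerset.filter (fun X => (W \ X) \ coloopsOf M (T ∪ W) ⊆ N ∧ ((W \ X) \ coloopsOf M (T ∪ W)).Nonempty),
      bracket M T X =
      ((StarTable.deltaStarN (N ∩ T).card (N ∩ W).card (coloopsOf M (T ∪ W)).card (L.map Finset.card) : ℤ) : ℚ) /
        (StarTable.Ls : ℚ) := by
  have hLW : coloopsOf M (T ∪ W) ⊆ W := coloopsOf_world_subset h hr
  have hdisjNL : Disjoint N (coloopsOf M (T ∪ W)) := disjoint_serClass_coloops hN
  -- (1) reindex by `Z = W ∖ X`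
  have hre : ∑ X ∈ W.powerset.filter (fun X => (W \ X) \ coloopsOf M (T ∪ W) ⊆ N ∧
      ((W \ X) \ coloopsOf M (T ∪ W)).Nonempty), bracket M T X =
      ∑ Z ∈ W.powerset.filter (fun Z => Z \ coloopsOf M (T ∪ W) ⊆ N ∧ (Z \ coloopsOf M (T ∪ W)).Nonempty),
        bracket M T (W \ Z) := by
    apply Finset.sum_nbij' (fun X => W \ X) (fun Z => W \ Z)
    · intro X hX
      rw [Finset.mem_filter, Finset.mem_powerset] at hX ⊢
      exact ⟨Finset.sdiff_subset, hX.2⟩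
    · intro Z hZ
      rw [Finset.mem_filter, Finset.mem_powerset] at hZ ⊢
      refine ⟨Finset.sdiff_subset, ?_⟩
      rw [Finset.sdiff_sdiff_eq_self hZ.1]
      exact hZ.2
    · intro X hX
      rw [Finset.mem_filter, Finset.mem_powerset] at hX
      exact Finset.sdiff_sdiff_eq_self hX.1
    · intro Z hZ
      rw [Finset.mem_filter, Finset.mem_powerset] at hZ
      exact Finset.sdiff_sdiff_eq_self hZ.1
    · intro X hX
      rw [Finset.mem_filter, Finset.mem_powerset] at hX
      rw [Finset.sdiff_sdiff_eq_self hX.1]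
  -- (2) the fibre is the set of `Z ⊆ (N ∩ W) ∪ L₀` meeting `N`
  have hfil : W.powerset.filter (fun Z => Z \ coloopsOf M (T ∪ W) ⊆ N ∧ (Z \ coloopsOf M (T ∪ W)).Nonempty) =
      ((N ∩ W) ∪ coloopsOf M (T ∪ W)).powerset.filter (fun Z => (Z ∩ N).Nonempty) := by
    ext Z
    rw [Finset.mem_filter, Finset.mem_filter, Finset.mem_powerset, Finset.mem_powerset]
    constructor
    · rintro ⟨hZW, hZN, hne⟩
      refine ⟨?_, ?_⟩
      · intro e he
        rw [Finset.mem_union]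
        by_cases heL : e ∈ coloopsOf M (T ∪ W)
        · exact Or.inr heL
        · exact Or.inl (Finset.mem_inter.2 ⟨hZN (Finset.mem_sdiff.2 ⟨he, heL⟩), hZW he⟩)
      · obtain ⟨e, he⟩ := hne
        rw [Finset.mem_sdiff] at he
        exact ⟨e, Finset.mem_inter.2 ⟨he.1, hZN (Finset.mem_sdiff.2 he)⟩⟩
    · rintro ⟨hZ, hne⟩
      refine ⟨hZ.trans (Finset.union_subset Finset.inter_subset_right hLW), ?_, ?_⟩
      · intro e he
        rw [Finset.mem_sdiff] at he
        rcases Finset.mem_union.1 (hZ he.1) with hh | hh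
        · exact (Finset.mem_inter.1 hh).1
        · exact absurd hh he.2
      · obtain ⟨e, he⟩ := hne
        rw [Finset.mem_inter] at he
        exact ⟨e, Finset.mem_sdiff.2 ⟨he.1, fun hL => Finset.disjoint_left.1 hdisjNL he.2 hL⟩⟩
  rw [hre, hfil, sum_filter_powerset_union (hdisjNL.mono_left Finset.inter_subset_left)]
  -- (3)+(4) the inner sums: the condition is `A.Nonempty`, the summand is `bracketN / Ls`
  have hinner : ∀ A ∈ (N ∩ W).powerset,
      ∑ B ∈ (coloopsOf M (T ∪ W)).powerset.filter (fun B => ((A ∪ B) ∩ N).Nonempty), bracket M T (W \ (A ∪ B)) =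
      if A.card = 0 then 0 else ∑ B ∈ (coloopsOf M (T ∪ W)).powerset,
        ((StarTable.bracketN (N ∩ T).card (N ∩ W).card (coloopsOf M (T ∪ W)).card (L.map Finset.card)
          A.card B.card : ℤ) : ℚ) / (StarTable.Ls : ℚ) := by
    intro A hA
    rw [Finset.mem_powerset] at hA
    have hAN : A ⊆ N := hA.trans Finset.inter_subset_left
    have hcond : ∀ B ∈ (coloopsOf M (T ∪ W)).powerset, ((A ∪ B) ∩ N).Nonempty ↔ A.Nonempty := by
      intro B hB
      rw [Finset.mem_powerset] at hB
      have : (A ∪ B) ∩ N = A := by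
        rw [Finset.union_inter_distrib_right, Finset.disjoint_iff_inter_eq_empty.1 (hdisjNL.symm.mono_left hB),
          Finset.union_empty]
        exact Finset.inter_eq_left.2 hAN
      rw [this]
    by_cases hA0 : A.card = 0
    · rw [if_pos hA0]
      apply Finset.sum_eq_zero
      intro B hB
      rw [Finset.mem_filter] at hB
      rw [hcond B hB.1] at hB
      exact absurd (Finset.card_eq_zero.1 hA0) (Finset.nonempty_iff_ne_empty.1 hB.2)
    · rw [if_neg hA0]
      have hAne : A.Nonempty := Finset.card_pos.1 (by omega)
      rw [Finset.filter_true_of_mem (fun B hB => (hcond B hB).2 hAne)]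
      apply Finset.sum_congr rfl
      intro B hB
      rw [Finset.mem_powerset] at hB
      have hZ : A ∪ B ⊆ (N ∩ W) ∪ coloopsOf M (T ∪ W) := Finset.union_subset_union hA hB
      have hZN : ((A ∪ B) ∩ N).Nonempty := (hcond B (Finset.mem_powerset.2 hB)).2 hAne
      have hb := bracket_eq_bracketN h hr hN hZ hZN hL hdiv
      have hAB1 : (A ∪ B) ∩ N = A := by
        rw [Finset.union_inter_distrib_right, Finset.disjoint_iff_inter_eq_empty.1 (hdisjNL.symm.mono_left hB),
          Finset.union_empty]
        exact Finset.inter_eq_left.2 hAN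
      have hAB2 : (A ∪ B) ∩ coloopsOf M (T ∪ W) = B := by
        rw [Finset.union_inter_distrib_right, Finset.disjoint_iff_inter_eq_empty.1 (hdisjNL.mono_left hAN),
          Finset.empty_union]
        exact Finset.inter_eq_left.2 hB
      rw [hAB1, hAB2] at hb
      rw [← hb]
      have hLs : (StarTable.Ls : ℚ) ≠ 0 := by exact_mod_cast Ls_pos.ne'
      field_simp
  rw [Finset.sum_congr rfl hinner]
  -- (5) group by the sizes
  rw [Finset.sum_powerset_apply_card (fun a => if a = 0 then (0 : ℚ) else ∑ B ∈ (coloopsOf M (T ∪ W)).powerset,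
    ((StarTable.bracketN (N ∩ T).card (N ∩ W).card (coloopsOf M (T ∪ W)).card (L.map Finset.card) a B.card : ℤ) : ℚ) /
      (StarTable.Ls : ℚ))]
  -- (6) the table's `deltaStarN`
  unfold StarTable.deltaStarN
  rw [StarCoeff.sumTo_eq_sum]
  push_cast
  rw [Finset.sum_div]
  apply Finset.sum_congr rfl
  intro zP _
  by_cases hzP : zP = 0
  · rw [if_pos hzP, if_pos hzP]
    simp
  · rw [if_neg hzP, if_neg hzP, StarCoeff.sumTo_eq_sum]
    rw [Finset.sum_powerset_apply_card (fun b => ((StarTable.bracketN (N ∩ T).card (N ∩ W).card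
      (coloopsOf M (T ∪ W)).card (L.map Finset.card) zP b : ℤ) : ℚ) / (StarTable.Ls : ℚ))]
    push_cast
    rw [nsmul_eq_mul, Finset.mul_sum, Finset.sum_div]
    apply Finset.sum_congr rfl
    intro zl _
    rw [nsmul_eq_mul]
    ring

end SevenThree

end PercRepro
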